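import Summits.QuantumFields.BalabanUV.Beta.GAN24.HardMinimiserOneStepSup
import Summits.QuantumFields.BalabanUV.Beta.GAN24.BlockFieldDecay

/-!
# G-an2-4 ∕ (CONV-C), road P2, route R2-S1 — THE ONE-STEP LAWS OF THE SCALAR MINIMISERS IN THE ROW'S KERNEL CURRENCY: from LOCALISED
# letters (per-block row decay), the one-step defects `M′ − J·M`, `S′ − S = Q′(M′ − JM)` and `H′ − J·H` have kernels decaying
# exponentially in the unit-lattice distance, with the rate `η = N⁻¹` in front — the «two clauses» shape (`OpClose`) for the unit-lattice
# operator `S = a′Q′G′Q′*` and for the fine-leg H-type constituents, modulo letters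

Unit `b2b-balaban-gan24-p2` (gen 29), BINDER row G-an2-4 ∕ (CONV-C), road P2.  `SoftMinimiserOneStepSup` ∕ `HardMinimiserOneStepSup` give
the all-sites SUP laws from GLOBAL sup → sup letters; the row's (CONV-C)∕`OpClose` currency (`GAN24/DirichletExhaustion`) is a KERNEL bound
`≤ ε·e^{−δ|y−y′|}`.  With the calculus of `GAN24/BlockFieldDecay` (`RowDecay` = the localised letter shape of [B5] (1.110): per-block row
sums `≤ C·e^{−δ|y−y′|_{T,∞}}`; `FieldDecay`; the resummation `fieldDecay_mulVec`, rate halved per composition) THIS FILE proves: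
 * §0 `rowDecay_of_bpt_row_sum` (the suppliers' integer-indexed per-block row bounds ⇒ `RowDecay`), `norm_mulVec_le_of_rowDecay` (`RowDecay` ⇒ the
   global sup → sup letter of the two sup-form files);
 * §1 **`fieldDecay_Msoft_succ_sub_stair`** — for a unit-lattice source `v` decaying from `y′` at rate `δ′ ≤ δ` (`|v(z)| ≤ V·e^{−δ′|z−y′|}`,
   e.g. `v = δ_{y′}`) and the four letters `G′_{RN}∇*∇*`, `G′_{RN}∇*`, `∇G′_N`, `∇*∇G′_N` in `RowDecay` form at rate `δ`:
   `|(M′v)(x′) − (Mv)(par x′)| ≤ ε(δ′)·V·e^{−(δ′/4)|blockOf x′ − y′|}`, `ε(δ′) = (d+1)·((R−1)∕(RN))·a′·(B₁C₁ + B₂C₂)·K(δ′/2)·K(δ′/4)`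
   (`K = B4Sect5Proof.latticeConst (d+1)`) — rate `η` AND decay;
 * §2 **`norm_Savg_succ_sub_apply_le`** — THE UNIT-LATTICE KERNEL: `|(S′ − S)(y, y′)| ≤ ε(δ)·e^{−(δ/4)|y − y′|}` for the scalar
   `S_n = a′Q′G′_nQ′*` at `n = N` and `n = RN` — the `OpClose` shape of `GAN24/DirichletExhaustion` on the unit torus, modulo the four letters;
 * §3 **`fieldDecay_Mhard_succ_sub_stair`** — the same for the HARD minimiser `H = M·S⁻¹`, with the two unit-lattice letters `S⁻¹`, `S′⁻¹`
   and the zeroth letter `G′_N` also in `RowDecay` form (rate ends at `δ/32`; every constant displayed).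
HONEST SCOPE.  Scalar (0-form) prototype, `U = 1`, finite torus written in dimension `d + 1`, every `N, R ≥ 1`, `a′ > 0`; bookkeeping over
the exact identities of the two minimiser files; ALL letters are DISPLAYED HYPOTHESES in the [shape] `RowDecay` (no named fact) and, for
the scalar `Gps`, NOT in the tree ((s0) located gap, GAPS § L-gan24leaf03-g48-1) — every END here is CONDITIONAL.  Locators (text only):
[Balaban1984PropagatorsI] (1.73) p. 30 (the soft solution operator `aG′Q′*`; LOCATOR CORRECTION of `SoftMinimiserOneStepSup.Msoft`'s tag «(1.103)
p.34», which prints the HARD minimiser — XREAD C-gan24leaf02-g43-1 NIT-1), (1.103) p. 34 (hard), (1.110) p. 35; [Balaban1983RegularityDecay] Sect. 5 (5.6) (the `OpClose` currency).  NOT (CONV-C) as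
typed (that is a statement about Bałaban's constituents with discharged inputs), NEVER «G-an2-4 closed», NOT NE2, NOT D1, NOT BetaPertH, NOT
continuum, NOT Clay; not in print — our proof attempt.  HONEST DEPENDENCY: continuum YM on T⁴ ⇐ BetaPertH ∧ nine spine estimates (0/9 proved);
BetaPertH ⇐ (D1) ∧ (D4) ∧ CAP+tail; G-an2-4 gates asym, D1 and NE2/3/4.
-/

noncomputable section

open scoped BigOperators ComplexConjugate Matrix

namespace Summit.QuantumFields.BalabanUV.Beta.GAN24.MinimiserOneStepDecay

open Literature.MathematicalPhysics.QuantumFieldTheory.Balaban1983to89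
open B5Prop11Plancherel (Tor fine)
open B5Action121 (sdiff)
open B5Block118 (bpt QsOp)
open B5Blocks16 (blockOf blockOf_bpt bpt_bijective)
open B6LowerBound2153Torus (toT rep toT_rep)
open B5Hk163TorusHolderRate (sum_exp_torusSupNorm_sub_rep_le)
open B4TorusKernel.MultiPeriod (torusSupNorm)
open B4Sect5Proof (latticeConst latticeConst_nonneg)
open Summit.QuantumFields.BalabanUV.T4Continuum.BalabanAveragedTowerModes (par)
open Summit.QuantumFields.BalabanUV.T4Continuum.ScalarAveragedPropagator (Gps)
open Summit.QuantumFields.BalabanUV.Beta.GAN24.StaircaseLaplacianDefect (stair stair_mulVec piL piF norm_piL_le norm_piF_le)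
open Summit.QuantumFields.BalabanUV.Beta.GAN24.SoftMinimiserOneStepSup (blkInj Msoft Msoft_mulVec Msoft_succ_sub_stair_eq_sum)
open Summit.QuantumFields.BalabanUV.Beta.GAN24.HardMinimiserOneStepSup (Savg Mhard Savg_succ_sub Mhard_succ_sub_stair)
open Summit.QuantumFields.BalabanUV.Beta.GAN24.BlockFieldDecay

variable {d : ℕ} (N R : ℕ) [NeZero N] [NeZero R] (M : Fin (d + 1) → ℕ) [hM : ∀ μ, NeZero (M μ)]

/-- the rate-and-letters constant of the soft law in decay currency:
`ε(δ′) = (d+1)·((R−1)∕(RN))·a′·(B₁C₁ + B₂C₂)·K(δ′/2)·K(δ′/4)`, `K = latticeConst (d+1)`. [folklore] -/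
def epsSoft (d N R : ℕ) (a' B₁ B₂ C₁ C₂ δ' : ℝ) : ℝ :=
  ((d : ℝ) + 1) * (((R : ℝ) - 1) / ((R : ℝ) * N)) * a' * (B₁ * C₁ + B₂ * C₂) *
    latticeConst (d + 1) (δ' / 2) * latticeConst (d + 1) (δ' / 4)

/-! ## §0 The suppliers' currency: per-block row sums indexed by integer representatives -/

section Currency

variable {M}
variable (n : ℕ) [NeZero n]

/-- **suppliers' shape ⇒ `RowDecay`**: a per-block row bound indexed by integer representatives (the shape of the G-an2-4 swarm's scalar
letters, e.g. `gps_block_row_sum_le`: `Σ_{r′} ‖K(n·x+r, n·x′+r′)‖ ≤ C·e^{−δ|x − x′|_{T,∞}}` for all `x x′ : ℤ^{d+1}`, `r`) gives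
`RowDecay M (blockOf n M) (blockOf n M) K C δ`. [folklore] -/
theorem rowDecay_of_bpt_row_sum (K : Matrix (Tor (fine n M)) (Tor (fine n M)) ℂ) {C δ : ℝ}
    (h : ∀ (x x' : Fin (d + 1) → ℤ) (r : Fin (d + 1) → Fin n),
      ∑ r', ‖K (bpt n M (toT M x) r) (bpt n M (toT M x') r')‖ ≤ C * Real.exp (-(δ * torusSupNorm M (x - x')))) :
    RowDecay M (blockOf n M) (blockOf n M) K C δ := by
  intro xf y'
  obtain ⟨⟨b, j⟩, rfl⟩ := (bpt_bijective n M).2 xf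
  have hre : (∑ x', if blockOf n M x' = y' then ‖K (bpt n M b j) x'‖ else 0) = ∑ r', ‖K (bpt n M b j) (bpt n M y' r')‖ := by
    rw [← (bpt_bijective n M).sum_comp (fun x' => if blockOf n M x' = y' then ‖K (bpt n M b j) x'‖ else 0),
      Fintype.sum_prod_type, Finset.sum_comm]
    refine Finset.sum_congr rfl fun r' _ => ?_
    simp only [blockOf_bpt]
    rw [Finset.sum_ite_eq', if_pos (Finset.mem_univ _)]
  dsimp only
  rw [hre, blockOf_bpt]
  have key := h (rep M b) (rep M y') j
  rwa [toT_rep, toT_rep] at key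

/-- **`RowDecay` ⇒ the global sup → sup letter** (the scalar twin of `Entry115SupCubic.norm_mulVec_le_of_block_row_sum`): for `δ > 0`,
`RowDecay M (blockOf n M) βᵢ K C δ → |g| ≤ b → ‖(Kg)(x)‖ ≤ C·K_{d+1}(δ)·b` — so the localised letters feed the sup-form ENDs of
`SoftMinimiserOneStepSup` ∕ `HardMinimiserOneStepSup` as well. [folklore] -/
theorem norm_mulVec_le_of_rowDecay {κ : Type*} [Fintype κ] [Nonempty κ] {βi : κ → Tor M} (K : Matrix (Tor (fine n M)) κ ℂ)
    {C δ : ℝ} (hK : RowDecay M (blockOf n M) βi K C δ) (hδ : 0 < δ) (g : κ → ℂ) (b : ℝ) (hg : ∀ z, ‖g z‖ ≤ b)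
    (x : Tor (fine n M)) : ‖(K *ᵥ g) x‖ ≤ C * latticeConst (d + 1) δ * b := by
  have hC : 0 ≤ C := by
    have h0 : (0 : ℝ) ≤ ∑ x', (if βi x' = blockOf n M x then ‖K x x'‖ else 0) :=
      Finset.sum_nonneg fun x' _ => by split_ifs <;> simp
    have h1 := h0.trans (hK x (blockOf n M x))
    rwa [sub_self, T4EtaRateOperatorTorus.torusSupNorm_zero, mul_zero, neg_zero, Real.exp_zero, mul_one] at h1
  obtain ⟨z₀⟩ := ‹Nonempty κ›
  have hb : 0 ≤ b := (norm_nonneg _).trans (hg z₀)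
  have hrow : ∑ x', ‖K x x'‖ ≤ C * latticeConst (d + 1) δ := by
    rw [sum_eq_sum_blocks (M := M) βi]
    calc ∑ y'' : Tor M, ∑ x', (if βi x' = y'' then ‖K x x'‖ else 0)
        ≤ ∑ y'' : Tor M, C * Real.exp (-(δ * torusSupNorm M (rep M (blockOf n M x) - rep M y''))) :=
          Finset.sum_le_sum fun y'' _ => hK x y''
      _ = C * ∑ y'' : Tor M, Real.exp (-(δ * torusSupNorm M (rep M (blockOf n M x) - rep M y''))) := by rw [Finset.mul_sum]
      _ ≤ C * latticeConst (d + 1) δ :=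
          mul_le_mul_of_nonneg_left (sum_exp_torusSupNorm_sub_rep_le M hδ (rep M (blockOf n M x))) hC
  calc ‖(K *ᵥ g) x‖ = ‖∑ x', K x x' * g x'‖ := by simp only [Matrix.mulVec, dotProduct]
    _ ≤ ∑ x', ‖K x x' * g x'‖ := norm_sum_le _ _
    _ ≤ ∑ x', ‖K x x'‖ * b := Finset.sum_le_sum fun x' _ => by
        rw [norm_mul]; exact mul_le_mul_of_nonneg_left (hg x') (norm_nonneg _)
    _ = (∑ x', ‖K x x'‖) * b := by rw [Finset.sum_mul]
    _ ≤ C * latticeConst (d + 1) δ * b := mul_le_mul_of_nonneg_right hrow hb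

end Currency

/-! ## §1 The soft law with decay -/

/-- one direction `μ`: the field `G′∂′_μᴴ(∂′_μᴴ(π^L_μ·J∂_μMv) + π^F_μ·J∂_μᴴ∂_μMv)` decays from `y′` at rate `δ′/4` with constant
`((R−1)∕(RN))·a′·(B₁C₁ + B₂C₂)·K(δ′/2)·K(δ′/4)·V`. [folklore] -/
theorem fieldDecay_dir_term {a' : ℝ} (ha' : 0 < a') (μ : Fin (d + 1)) {B₁ B₂ C₁ C₂ δ δ' V : ℝ} (hδ' : 0 < δ') (hδ'δ : δ' ≤ δ)
    (hB₁ : RowDecay M (blockOf (R * N) M) (blockOf (R * N) M)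
      (Gps (R * N) M a' * (sdiff (fine (R * N) M) ((R * N : ℕ) : ℂ) μ)ᴴ * (sdiff (fine (R * N) M) ((R * N : ℕ) : ℂ) μ)ᴴ) B₁ δ)
    (hB₂ : RowDecay M (blockOf (R * N) M) (blockOf (R * N) M) (Gps (R * N) M a' * (sdiff (fine (R * N) M) ((R * N : ℕ) : ℂ) μ)ᴴ) B₂ δ)
    (hC₁ : RowDecay M (blockOf N M) (blockOf N M) (sdiff (fine N M) ((N : ℕ) : ℂ) μ * Gps N M a') C₁ δ)
    (hC₂ : RowDecay M (blockOf N M) (blockOf N M)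
      ((sdiff (fine N M) ((N : ℕ) : ℂ) μ)ᴴ * sdiff (fine N M) ((N : ℕ) : ℂ) μ * Gps N M a') C₂ δ)
    {v : Tor M → ℂ} {y' : Tor M} (hV : 0 ≤ V) (hv : FieldDecay M id v V δ' y') :
    FieldDecay M (blockOf (R * N) M)
      (Gps (R * N) M a' *ᵥ ((sdiff (fine (R * N) M) ((R * N : ℕ) : ℂ) μ)ᴴ *ᵥ
        (((sdiff (fine (R * N) M) ((R * N : ℕ) : ℂ) μ)ᴴ *ᵥ
            (fun z => piL N R M μ z * (stair N R M *ᵥ (sdiff (fine N M) ((N : ℕ) : ℂ) μ *ᵥ (Msoft N M a' *ᵥ v))) z))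
          + (fun z => piF N R M μ z * (stair N R M *ᵥ ((sdiff (fine N M) ((N : ℕ) : ℂ) μ)ᴴ *ᵥ
              (sdiff (fine N M) ((N : ℕ) : ℂ) μ *ᵥ (Msoft N M a' *ᵥ v)))) z))))
      ((((R : ℝ) - 1) / ((R : ℝ) * N)) * a' * (B₁ * C₁ + B₂ * C₂) * latticeConst (d + 1) (δ' / 2) *
        latticeConst (d + 1) (δ' / 4) * V) (δ' / 4) y' := by
  have hR : 0 < R := Nat.pos_of_ne_zero (NeZero.ne R)
  have hR1 : (1 : ℝ) ≤ R := by exact_mod_cast hR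
  have hρ : 0 ≤ ((R : ℝ) - 1) / ((R : ℝ) * N) := div_nonneg (by linarith) (by positivity)
  have hK2 : 0 ≤ latticeConst (d + 1) (δ' / 2) := latticeConst_nonneg _ (by linarith)
  have hK4 : 0 ≤ latticeConst (d + 1) (δ' / 4) := latticeConst_nonneg _ (by linarith)
  have hB₁0 : 0 ≤ B₁ := hB₁.nonneg
  have hB₂0 : 0 ≤ B₂ := hB₂.nonneg
  have hC₁0 : 0 ≤ C₁ := hC₁.nonneg
  have hC₂0 : 0 ≤ C₂ := hC₂.nonneg
  set ρ := ((R : ℝ) - 1) / ((R : ℝ) * N) with hρ_def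
  set D := sdiff (fine N M) ((N : ℕ) : ℂ) μ with hD
  set D' := sdiff (fine (R * N) M) ((R * N : ℕ) : ℂ) μ with hD'
  -- the planted source `f = a′·Q′*v` decays at rate δ′ from `y′`
  have hf : FieldDecay M (blockOf N M) ((a' : ℂ) • (blkInj N M *ᵥ v)) (a' * V) δ' y' := by
    have h := (fieldDecay_blkInj (M := M) N hv).smul (a' : ℂ)
    rwa [Complex.norm_real, Real.norm_of_nonneg ha'.le] at h
  -- `u₁ = ∂_μ(Mv) = (∂_μG′_N)f`, `u₂ = ∂_μᴴ∂_μ(Mv) = (∂_μᴴ∂_μG′_N)f`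
  have hu₁ : FieldDecay M (blockOf N M) (D *ᵥ (Msoft N M a' *ᵥ v)) (C₁ * (a' * V) * latticeConst (d + 1) (δ' / 2)) (δ' / 2) y' := by
    rw [Msoft_mulVec, Matrix.mulVec_mulVec]
    exact fieldDecay_mulVec (hC₁.mono le_rfl hC₁0 hδ'δ) hδ' hf (by positivity)
  have hu₂ : FieldDecay M (blockOf N M) (Dᴴ *ᵥ (D *ᵥ (Msoft N M a' *ᵥ v)))
      (C₂ * (a' * V) * latticeConst (d + 1) (δ' / 2)) (δ' / 2) y' := by
    rw [Msoft_mulVec, Matrix.mulVec_mulVec, Matrix.mulVec_mulVec]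
    exact fieldDecay_mulVec (hC₂.mono le_rfl hC₂0 hδ'δ) hδ' hf (by positivity)
  -- the two O(η) sources
  have hg₁ : FieldDecay M (blockOf (R * N) M) (fun z => piL N R M μ z * (stair N R M *ᵥ (D *ᵥ (Msoft N M a' *ᵥ v))) z)
      (ρ * (C₁ * (a' * V) * latticeConst (d + 1) (δ' / 2))) (δ' / 2) y' :=
    (fieldDecay_stair (M := M) N R hu₁).mul_left _ (norm_piL_le N R M μ)
  have hg₂ : FieldDecay M (blockOf (R * N) M)
      (fun z => piF N R M μ z * (stair N R M *ᵥ (Dᴴ *ᵥ (D *ᵥ (Msoft N M a' *ᵥ v)))) z)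
      (ρ * (C₂ * (a' * V) * latticeConst (d + 1) (δ' / 2))) (δ' / 2) y' :=
    (fieldDecay_stair (M := M) N R hu₂).mul_left _ (norm_piF_le N R M μ)
  -- through the two fine-level letters (rate δ′/2 → δ′/4)
  have hδ2 : 0 < δ' / 2 := half_pos hδ'
  have hδ2δ : δ' / 2 ≤ δ := by linarith
  have hT₁ := fieldDecay_mulVec (hB₁.mono le_rfl hB₁0 hδ2δ) hδ2 hg₁ (by positivity)
  have hT₂ := fieldDecay_mulVec (hB₂.mono le_rfl hB₂0 hδ2δ) hδ2 hg₂ (by positivity)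
  have e : Gps (R * N) M a' *ᵥ (D'ᴴ *ᵥ (D'ᴴ *ᵥ
        (fun z => piL N R M μ z * (stair N R M *ᵥ (D *ᵥ (Msoft N M a' *ᵥ v))) z)
        + (fun z => piF N R M μ z * (stair N R M *ᵥ (Dᴴ *ᵥ (D *ᵥ (Msoft N M a' *ᵥ v)))) z)))
      = (Gps (R * N) M a' * D'ᴴ * D'ᴴ) *ᵥ (fun z => piL N R M μ z * (stair N R M *ᵥ (D *ᵥ (Msoft N M a' *ᵥ v))) z)
        + (Gps (R * N) M a' * D'ᴴ) *ᵥ (fun z => piF N R M μ z * (stair N R M *ᵥ (Dᴴ *ᵥ (D *ᵥ (Msoft N M a' *ᵥ v)))) z) := by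
    simp only [Matrix.mulVec_add, ← Matrix.mulVec_mulVec]
  rw [e]
  have hsum := hT₁.add hT₂
  refine hsum.mono (le_of_eq ?_) (by positivity) (by linarith)
  rw [show δ' / 2 / 2 = δ' / 4 by ring]
  ring

/-- **THE SOFT LAW WITH DECAY.**  Letters `G′_{RN}∇_μ*∇_μ*`, `G′_{RN}∇_μ*`, `∇_μG′_N`, `∇_μ*∇_μG′_N` in `RowDecay` form at rate `δ` (every direction
`μ`), a unit-lattice source `v` with `|v(z)| ≤ V·e^{−δ′|z − y′|}` (`0 < δ′ ≤ δ`); then the one-step defect of the soft minimiser decays from `y′`: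
`|(M′v)(x′) − (J·Mv)(x′)| ≤ ε(δ′)·V·e^{−(δ′/4)·|blockOf x′ − y′|_{T,∞}}` at every fine site `x′`. [folklore] -/
theorem fieldDecay_Msoft_succ_sub_stair {a' : ℝ} (ha' : 0 < a') {B₁ B₂ C₁ C₂ δ δ' V : ℝ} (hδ' : 0 < δ') (hδ'δ : δ' ≤ δ)
    (hB₁ : ∀ μ, RowDecay M (blockOf (R * N) M) (blockOf (R * N) M)
      (Gps (R * N) M a' * (sdiff (fine (R * N) M) ((R * N : ℕ) : ℂ) μ)ᴴ * (sdiff (fine (R * N) M) ((R * N : ℕ) : ℂ) μ)ᴴ) B₁ δ)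
    (hB₂ : ∀ μ, RowDecay M (blockOf (R * N) M) (blockOf (R * N) M)
      (Gps (R * N) M a' * (sdiff (fine (R * N) M) ((R * N : ℕ) : ℂ) μ)ᴴ) B₂ δ)
    (hC₁ : ∀ μ, RowDecay M (blockOf N M) (blockOf N M) (sdiff (fine N M) ((N : ℕ) : ℂ) μ * Gps N M a') C₁ δ)
    (hC₂ : ∀ μ, RowDecay M (blockOf N M) (blockOf N M)
      ((sdiff (fine N M) ((N : ℕ) : ℂ) μ)ᴴ * sdiff (fine N M) ((N : ℕ) : ℂ) μ * Gps N M a') C₂ δ)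
    {v : Tor M → ℂ} {y' : Tor M} (hV : 0 ≤ V) (hv : FieldDecay M id v V δ' y') :
    FieldDecay M (blockOf (R * N) M) (Msoft (R * N) M a' *ᵥ v - stair N R M *ᵥ (Msoft N M a' *ᵥ v))
      (epsSoft d N R a' B₁ B₂ C₁ C₂ δ' * V) (δ' / 4) y' := by
  rw [Msoft_succ_sub_stair_eq_sum N R M ha', Matrix.mulVec_sum]
  have h := (FieldDecay.sum_univ fun μ => fieldDecay_dir_term N R M ha' μ hδ' hδ'δ (hB₁ μ) (hB₂ μ) (hC₁ μ) (hC₂ μ) hV hv).neg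
  refine h.mono (le_of_eq ?_) ?_ le_rfl
  · rw [Fintype.card_fin, epsSoft]; push_cast; ring
  · have hR : 0 < R := Nat.pos_of_ne_zero (NeZero.ne R)
    have hR1 : (1 : ℝ) ≤ R := by exact_mod_cast hR
    have hρ : 0 ≤ ((R : ℝ) - 1) / ((R : ℝ) * N) := div_nonneg (by linarith) (by positivity)
    have := (hB₁ 0).nonneg; have := (hB₂ 0).nonneg; have := (hC₁ 0).nonneg; have := (hC₂ 0).nonneg
    have hK2 : 0 ≤ latticeConst (d + 1) (δ' / 2) := latticeConst_nonneg _ (by linarith)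
    have hK4 : 0 ≤ latticeConst (d + 1) (δ' / 4) := latticeConst_nonneg _ (by linarith)
    unfold epsSoft; positivity

/-! ## §2 The unit-lattice kernel `S′ − S` -/

omit hM in
/-- the indicator source `δ_{y′}` decays from `y′` at every rate, with constant `1`. [folklore] -/
theorem fieldDecay_single (δ : ℝ) (y' : Tor M) :
    FieldDecay M id (Pi.single y' (1 : ℂ)) 1 δ y' :=
  fieldDecay_of_supp δ (fun z => by
      by_cases h : z = y'
      · rw [h, Pi.single_eq_same, norm_one]
      · rw [Pi.single_eq_of_ne h, norm_zero]; exact zero_le_one)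
    (fun z hz => Pi.single_eq_of_ne hz _)

/-- **THE UNIT-LATTICE ONE-STEP KERNEL DECAYS**: for the scalar `S_n = a′Q′G′_nQ′*` (`HardMinimiserOneStepSup.Savg`), under the four
letters of §1 at rate `δ > 0`: `|(S_{RN} − S_N)(y, y′)| ≤ ε(δ)·e^{−(δ/4)·|y − y′|_{T,∞}}` — the `OpClose` shape on the unit torus
(`S′ − S = Q′(M′ − J·M)` is the block mean of the soft defect). [folklore] -/
theorem norm_Savg_succ_sub_apply_le {a' : ℝ} (ha' : 0 < a') {B₁ B₂ C₁ C₂ δ : ℝ} (hδ : 0 < δ)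
    (hB₁ : ∀ μ, RowDecay M (blockOf (R * N) M) (blockOf (R * N) M)
      (Gps (R * N) M a' * (sdiff (fine (R * N) M) ((R * N : ℕ) : ℂ) μ)ᴴ * (sdiff (fine (R * N) M) ((R * N : ℕ) : ℂ) μ)ᴴ) B₁ δ)
    (hB₂ : ∀ μ, RowDecay M (blockOf (R * N) M) (blockOf (R * N) M)
      (Gps (R * N) M a' * (sdiff (fine (R * N) M) ((R * N : ℕ) : ℂ) μ)ᴴ) B₂ δ)
    (hC₁ : ∀ μ, RowDecay M (blockOf N M) (blockOf N M) (sdiff (fine N M) ((N : ℕ) : ℂ) μ * Gps N M a') C₁ δ)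
    (hC₂ : ∀ μ, RowDecay M (blockOf N M) (blockOf N M)
      ((sdiff (fine N M) ((N : ℕ) : ℂ) μ)ᴴ * sdiff (fine N M) ((N : ℕ) : ℂ) μ * Gps N M a') C₂ δ)
    (y y' : Tor M) :
    ‖(Savg (R * N) M a' - Savg N M a') y y'‖
      ≤ epsSoft d N R a' B₁ B₂ C₁ C₂ δ * Real.exp (-(δ / 4 * torusSupNorm M (rep M y - rep M y'))) := by
  have hcol : (Savg (R * N) M a' - Savg N M a') y y'
      = (QsOp (R * N) M *ᵥ ((Msoft (R * N) M a' - stair N R M * Msoft N M a') *ᵥ Pi.single y' (1 : ℂ))) y := by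
    rw [Matrix.mulVec_mulVec, ← Savg_succ_sub, Matrix.mulVec_single_one, Matrix.col_apply]
  rw [hcol]
  have hsoft := fieldDecay_Msoft_succ_sub_stair N R M ha' hδ le_rfl hB₁ hB₂ hC₁ hC₂ zero_le_one (fieldDecay_single (M := M) δ y')
  rw [mul_one] at hsoft
  have hD : FieldDecay M (blockOf (R * N) M) ((Msoft (R * N) M a' - stair N R M * Msoft N M a') *ᵥ Pi.single y' (1 : ℂ))
      (epsSoft d N R a' B₁ B₂ C₁ C₂ δ) (δ / 4) y' := by
    rw [Matrix.sub_mulVec, ← Matrix.mulVec_mulVec]; exact hsoft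
  exact fieldDecay_QsOp (M := M) (R * N) hD y

/-! ## §3 The hard law with decay -/

/-- **THE HARD LAW WITH DECAY.**  In addition to the four letters of §1 (rate `δ`): the zeroth letter `G′_N` (`RowDecay … (Gps N M a′) C₀ δ`) and the
two unit-lattice letters `S_N⁻¹`, `S_{RN}⁻¹` (`RowDecay M id id (Savg n M a′)⁻¹ σ δ`); then for a source `v` with `|v(z)| ≤ V·e^{−δ|z − y′|}` the
one-step defect of the HARD minimiser decays from `y′` at rate `δ/32` with the displayed constant — via the exact identity
`H′v − J(Hv) = (M′ − JM)(S′⁻¹v) − J·M·S′⁻¹·Q′·(M′ − JM)(S⁻¹v)` of `HardMinimiserOneStepSup`. [folklore] -/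
theorem fieldDecay_Mhard_succ_sub_stair {a' : ℝ} (ha' : 0 < a') {B₁ B₂ C₁ C₂ C₀ σ σ' δ V : ℝ} (hδ : 0 < δ)
    (hB₁ : ∀ μ, RowDecay M (blockOf (R * N) M) (blockOf (R * N) M)
      (Gps (R * N) M a' * (sdiff (fine (R * N) M) ((R * N : ℕ) : ℂ) μ)ᴴ * (sdiff (fine (R * N) M) ((R * N : ℕ) : ℂ) μ)ᴴ) B₁ δ)
    (hB₂ : ∀ μ, RowDecay M (blockOf (R * N) M) (blockOf (R * N) M)
      (Gps (R * N) M a' * (sdiff (fine (R * N) M) ((R * N : ℕ) : ℂ) μ)ᴴ) B₂ δ)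
    (hC₁ : ∀ μ, RowDecay M (blockOf N M) (blockOf N M) (sdiff (fine N M) ((N : ℕ) : ℂ) μ * Gps N M a') C₁ δ)
    (hC₂ : ∀ μ, RowDecay M (blockOf N M) (blockOf N M)
      ((sdiff (fine N M) ((N : ℕ) : ℂ) μ)ᴴ * sdiff (fine N M) ((N : ℕ) : ℂ) μ * Gps N M a') C₂ δ)
    (hC₀ : RowDecay M (blockOf N M) (blockOf N M) (Gps N M a') C₀ δ)
    (hS : RowDecay M id id (Savg N M a')⁻¹ σ δ) (hS' : RowDecay M id id (Savg (R * N) M a')⁻¹ σ' δ)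
    {v : Tor M → ℂ} {y' : Tor M} (hV : 0 ≤ V) (hv : FieldDecay M id v V δ y') :
    FieldDecay M (blockOf (R * N) M) (Mhard (R * N) M a' *ᵥ v - stair N R M *ᵥ (Mhard N M a' *ᵥ v))
      (epsSoft d N R a' B₁ B₂ C₁ C₂ (δ / 2) * (σ' * V * latticeConst (d + 1) (δ / 2))
        + C₀ * (a' * (σ' * (epsSoft d N R a' B₁ B₂ C₁ C₂ (δ / 2) * (σ * V * latticeConst (d + 1) (δ / 2)))
            * latticeConst (d + 1) (δ / 16))) * latticeConst (d + 1) (δ / 32))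
      (δ / 32) y' := by
  have hσ0 : 0 ≤ σ := hS.nonneg
  have hσ'0 : 0 ≤ σ' := hS'.nonneg
  have hC₀0 : 0 ≤ C₀ := hC₀.nonneg
  have hε0 : 0 ≤ epsSoft d N R a' B₁ B₂ C₁ C₂ (δ / 2) := by
    have hR : 0 < R := Nat.pos_of_ne_zero (NeZero.ne R)
    have hR1 : (1 : ℝ) ≤ R := by exact_mod_cast hR
    have hρ : 0 ≤ ((R : ℝ) - 1) / ((R : ℝ) * N) := div_nonneg (by linarith) (by positivity)
    have := (hB₁ 0).nonneg; have := (hB₂ 0).nonneg; have := (hC₁ 0).nonneg; have := (hC₂ 0).nonneg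
    have hK2 : 0 ≤ latticeConst (d + 1) (δ / 2 / 2) := latticeConst_nonneg _ (by linarith)
    have hK4 : 0 ≤ latticeConst (d + 1) (δ / 2 / 4) := latticeConst_nonneg _ (by linarith)
    unfold epsSoft; positivity
  have hK2 : 0 ≤ latticeConst (d + 1) (δ / 2) := latticeConst_nonneg _ (by linarith)
  have hK16 : 0 ≤ latticeConst (d + 1) (δ / 16) := latticeConst_nonneg _ (by linarith)
  have hδ2 : 0 < δ / 2 := by linarith
  -- `w′ = S′⁻¹v`, `w = S⁻¹v` decay at rate δ/2
  have hw' := fieldDecay_mulVec hS' hδ hv hV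
  have hw := fieldDecay_mulVec hS hδ hv hV
  -- the soft defect on them (letters at rate δ ≥ δ/2): rate δ/8
  have hD' := fieldDecay_Msoft_succ_sub_stair N R M ha' hδ2 (by linarith) hB₁ hB₂ hC₁ hC₂ (by positivity) hw'
  have hD := fieldDecay_Msoft_succ_sub_stair N R M ha' hδ2 (by linarith) hB₁ hB₂ hC₁ hC₂ (by positivity) hw
  -- the correction term: Q′, S′⁻¹ (δ/8 → δ/16), M = G′(a′Q′*·) (δ/16 → δ/32), J
  have hQ := fieldDecay_QsOp (M := M) (R * N) hD
  have hδ8 : 0 < δ / 2 / 4 := by linarith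
  have hSQ := fieldDecay_mulVec (hS'.mono le_rfl hσ'0 (by linarith : δ / 2 / 4 ≤ δ)) hδ8 hQ (by positivity)
  have hbl : FieldDecay M (blockOf N M) ((a' : ℂ) • (blkInj N M *ᵥ ((Savg (R * N) M a')⁻¹ *ᵥ (QsOp (R * N) M *ᵥ
      (Msoft (R * N) M a' *ᵥ ((Savg N M a')⁻¹ *ᵥ v) - stair N R M *ᵥ (Msoft N M a' *ᵥ ((Savg N M a')⁻¹ *ᵥ v)))))))
      (a' * (σ' * (epsSoft d N R a' B₁ B₂ C₁ C₂ (δ / 2) * (σ * V * latticeConst (d + 1) (δ / 2)))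
        * latticeConst (d + 1) (δ / 2 / 4 / 2))) (δ / 2 / 4 / 2) y' := by
    have h := (fieldDecay_blkInj (M := M) N hSQ).smul (a' : ℂ)
    rwa [Complex.norm_real, Real.norm_of_nonneg ha'.le] at h
  have hδ16 : 0 < δ / 2 / 4 / 2 := by linarith
  have hK16' : 0 ≤ latticeConst (d + 1) (δ / 2 / 4 / 2) := latticeConst_nonneg _ (by linarith)
  have hK32' : 0 ≤ latticeConst (d + 1) (δ / 2 / 4 / 2 / 2) := latticeConst_nonneg _ (by linarith)
  have hMz := fieldDecay_mulVec (hC₀.mono le_rfl hC₀0 (by linarith : δ / 2 / 4 / 2 ≤ δ)) hδ16 hbl (by positivity)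
  have hJ := fieldDecay_stair (M := M) N R hMz
  -- assemble along the exact identity
  rw [Mhard_succ_sub_stair N R M ha']
  have hfirst : FieldDecay M (blockOf (R * N) M)
      ((Msoft (R * N) M a' - stair N R M * Msoft N M a') *ᵥ ((Savg (R * N) M a')⁻¹ *ᵥ v))
      (epsSoft d N R a' B₁ B₂ C₁ C₂ (δ / 2) * (σ' * V * latticeConst (d + 1) (δ / 2))) (δ / 2 / 4) y' := by
    rw [Matrix.sub_mulVec, ← Matrix.mulVec_mulVec]; exact hD'
  have hsecond : FieldDecay M (blockOf (R * N) M)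
      (stair N R M *ᵥ (Msoft N M a' *ᵥ ((Savg (R * N) M a')⁻¹ *ᵥ (QsOp (R * N) M *ᵥ
        ((Msoft (R * N) M a' - stair N R M * Msoft N M a') *ᵥ ((Savg N M a')⁻¹ *ᵥ v))))))
      (C₀ * (a' * (σ' * (epsSoft d N R a' B₁ B₂ C₁ C₂ (δ / 2) * (σ * V * latticeConst (d + 1) (δ / 2)))
        * latticeConst (d + 1) (δ / 2 / 4 / 2))) * latticeConst (d + 1) (δ / 2 / 4 / 2 / 2)) (δ / 2 / 4 / 2 / 2) y' := by
    rw [Msoft_mulVec, Matrix.sub_mulVec, ← Matrix.mulVec_mulVec]; exact hJ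
  have hsum := (hfirst.mono le_rfl (by positivity) (by linarith : δ / 2 / 4 / 2 / 2 ≤ δ / 2 / 4)).sub hsecond
  have e16 : δ / 2 / 4 / 2 = δ / 16 := by ring
  have e32 : δ / 2 / 4 / 2 / 2 = δ / 32 := by ring
  rw [e32, e16] at hsum
  have hK32 : 0 ≤ latticeConst (d + 1) (δ / 32) := latticeConst_nonneg _ (by linarith)
  refine hsum.mono (le_of_eq ?_) (by positivity) le_rfl
  ring

end Summit.QuantumFields.BalabanUV.Beta.GAN24.MinimiserOneStepDecay

end
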